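import Literature.AlgebraicGeometry.Villamayor2007.CharPolyGenerators
import Mathlib.RingTheory.Polynomial.ScaleRoots
import Mathlib.Algebra.Polynomial.Taylor
import Mathlib.RingTheory.Ideal.Quotient.Operations
import HarnessLib

/-!
# Villamayor 2007, §1.5 (p0007 L57–L60, L80–L83): the elimination ideals `I_r` do not depend on the changes of
# variable `Z₁ = Z − s` and `Z₁ = uZ − s` — PROVED at the level of COEFFICIENTS

O. E. Villamayor U., *Hypersurface singularities in positive characteristic*, Adv. Math. **213** (2007)
687–733 = arXiv:math/0606796 [Villamayor2007]; locators «p00NN Lnn» = chunk · line of the held arXiv text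
(`lit read paper:arxiv-math_0606796`, chunks p0006–p0007 re-read before typing). Sequel of
`UniversalElimination.lean` (`R̄_b = univElimOne`, translation invariance AT THE LEVEL OF ROOTS:
`aeval_add_const_of_mem_diffSubalgebra`), `EliminationAlgebra.lean` (`specialize`, `monicOf`, `coeffVec`,
`elimIdeal = I_r`, `elimAlgebra = R̄_f`) and `CharPolyGenerators.lean` (`hElimIdeal`, `hElimAlgebra = ℋ_f`).
Campaign `res-hironaka` (D-0089), ladder rung LIT-6. PROOF file: theorems only, no definitions, no named facts;
nothing of Hironaka's 2017 manuscript is referred to.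

## What is proved (the printed claims of §1.5 about coordinate changes)

* p0006 L50–L52: «changes of variables of the form `Z₁ = Z − s`, `s ∈ S` do not affect the finite extension
  `S ⊂ S[Z]/⟨f(Z)⟩`.»
* p0007 L57–L60: «Elements of `R̄_b`, are elements in `R_b`, that provide, for every monic polynomial `f(Z) ∈ S[Z]`
  of degree `b`, equations on the coefficients which are independent of changes of the form `Z₁ = Z − s`, `s ∈ S`.»
* p0007 L80–L83: «Now for each index `r`, the ideal `I_r` is generated by polynomials on the coefficients of
  `f(Z)`. They are clearly invariants by a change of variable `Z₁ = Z − s`, `s ∈ S`, as each `h_i` is invariant by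
  such change. But the point is that each ideal `I_r` will be independent of any change `Z₁ = uZ − s` in `S[Z]`.
  This last property will rely on the fact that the previous (universal) `H_i` are weighted homogeneous on the
  symmetric functions `s_{b,i}`.» (`u` a unit of `S`, p0007 L40 «`Z₁ = uZ − s`, where `s ∈ S` and `u` is a unit
  of `S`».)

In coordinates (`f = monicOf a = Z^b + a₁Z^{b−1} + ⋯ + a_b`, `a i = a_{i+1}`): the change `Z₁ = Z − s` replaces
`f(Z)` by `f(Z₁ + s)` = Mathlib's `Polynomial.taylor s f`, with coefficient vector `coeffVec b (taylor s f)`; the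
change `Z₁ = uZ` replaces `f` by `u^b f(Z₁/u)`, i.e. `a_i ↦ u^i a_i` (the vector `fun i => a i * u ^ (i+1)`; for
`u` arbitrary this is Mathlib's `Polynomial.scaleRoots f u`, `coeffVec_scaleRoots_monicOf`). MAIN THEOREMS, for
every commutative ring `k`, every `k`-algebra `S`, `a : Fin b → S`, `s u : S`:

* `specialize_taylor`: for every `G ∈ R̄_b`, `specialize (coeffVec b (taylor s (monicOf a))) G = specialize a G`
  — the «equation on the coefficients» `G` takes THE SAME VALUE before and after `Z₁ = Z − s` (all `G ∈ R̄_b`, not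
  only homogeneous ones);
* `specialize_scale`: for `G ∈ [R̄_b]_r` homogeneous of degree `r`, `specialize (fun i => a i * u^(i+1)) G =
  u ^ r * specialize a G` (any `u ∈ S`);
* hence `elimIdeal_taylor : I_r(f(Z+s)) = I_r(f)`, `elimAlgebra_taylor : R̄_{f(Z+s)} = R̄_f`, `elimIdeal_scale :
  I_r(u • f) = u^r · I_r(f)` and `= I_r(f)` for `u` a unit (`elimIdeal_scale_of_isUnit`), the combined change
  `Z₁ = uZ − s` (`elimIdeal_scale_taylor_of_isUnit`), the same for `ℋ_f` (`hElimIdeal_taylor`, …), and the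
  versions for an arbitrary monic `f` of degree `b` (`elimIdeal_taylor_of_monic`, `elimIdeal_scaleRoots_of_monic`).

METHOD (the printed one: «each `h_i` is invariant by such change» = the root-level invariance, transported to
coefficients through the universal polynomial). Both sides are natural in `(S, a, s, u)`, so it suffices to treat
the universal coefficient ring `S₀ = k[T][E₁,…,E_b]` (`a₀ i = (−1)^{i+1} E_i`, `s₀ = u₀ = T`). There the map
`Φ : E_i ↦ s_{b,i}(Y)` into `k[T][Y₁,…,Y_b]` is INJECTIVE (the injectivity half of the fundamental theorem of
symmetric polynomials, Mathlib `MvPolynomial.esymmAlgHom_injective`), it sends `monicOf a₀` to `F_b(Z) = ∏ (Z − Y_i)`,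
`taylor T F_b = ∏ (Z − (Y_i − T))`, and `specialize` at the coefficients of `F_b` is the inclusion `R̄_b ⊂ k[Y]`
(`specialize_coeffVec_univMonic`); so the claim becomes `G(Y₁ − T, …, Y_b − T) = G(Y)` resp. `G(T·Y) = T^r G(Y)`,
i.e. `aeval_add_const_of_mem_diffSubalgebra` resp. homogeneity (`aeval_const_mul_of_isHomogeneous`).

## References

* O. E. Villamayor U., Adv. Math. 213 (2007) 687–733 = arXiv:math/0606796: §1.1 p0006 L50–L52, §1.5 p0007 L35–L42,
  L57–L60, L80–L83. [Villamayor2007]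
-/

noncomputable section

open scoped Polynomial

namespace Literature.AlgebraicGeometry.Villamayor2007

open MvPolynomial

universe u v w

/-! ## Root level: behaviour of homogeneous invariants under `Y ↦ u·Y + c` -/

section RootLevel

variable {k : Type v} [CommRing k] {ι : Type u}

/-- Homogeneous polynomials of degree `r` scale by `u^r` under `Y ↦ u·Y` («weighted homogeneous», p0007 L83).
[cite: Villamayor2007, §1.5 p0007 L80–L83] -/
theorem aeval_const_mul_of_isHomogeneous {A : Type w} [CommRing A] [Algebra k A] (y : ι → A) (c : A)
    {G : MvPolynomial ι k} {r : ℕ} (hG : G.IsHomogeneous r) :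
    aeval (fun i => c * y i) G = c ^ r * aeval y G := by
  classical
  simp only [MvPolynomial.aeval_def, MvPolynomial.eval₂_eq]
  rw [Finset.mul_sum]
  refine Finset.sum_congr rfl fun d hd => ?_
  rw [hG.degree_eq_sum_deg_support hd]
  simp only [mul_pow, Finset.prod_mul_distrib, Finset.prod_pow_eq_pow_sum]
  ring

/-- The combined root change `Y ↦ u·Y + c` on a homogeneous universal elimination invariant of degree `r`
(`G ∈ [R̄]_r`): the value is multiplied by `u^r` (translation part invisible by `aeval_add_const_of_mem_univElim`).
[cite: Villamayor2007, §1.5 p0007 L80–L83] -/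
theorem aeval_const_mul_add_const_of_mem_univElimPiece {β : Type*} {blk : ι → β} {A : Type w} [CommRing A]
    [Algebra k A] (y : ι → A) (c d : A) {G : MvPolynomial ι k} {r : ℕ}
    (hG : G ∈ univElimPiece ι k blk r) :
    aeval (fun i => c * y i + d) G = c ^ r * aeval y G := by
  rw [aeval_add_const_of_mem_univElim (fun i => c * y i) d hG.1, aeval_const_mul_of_isHomogeneous y c hG.2]

/-- The elementary symmetric polynomial `s_{b,n}` is homogeneous of degree `n` (p0007 L3–L5 «each `s_{b,i}` is
homogeneous of degree `i`»). [cite: Villamayor2007, §1.5 p0007 L3–L5] -/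
theorem isHomogeneous_esymm_univ [Fintype ι] (n : ℕ) : (esymm ι k n).IsHomogeneous n := by
  have h := isHomogeneous_esymm_map (k := k) (Finset.univ : Finset ι) (fun i => (X i : MvPolynomial ι k))
    (d := 1) (fun i _ => isHomogeneous_X k i) n
  rw [mul_one] at h
  rwa [esymm_eq_multiset_esymm]

end RootLevel

/-! ## Polynomial bookkeeping: `monicOf`, `coeffVec`, `taylor`, `scaleRoots` under ring maps -/

section PolyLemmas

variable {A : Type u} [CommRing A] {B : Type v} [CommRing B] {b : ℕ}

/-- `coeffVec` commutes with ring maps. [cite: Villamayor2007, Def. 1.2 p0006 L67–L68] -/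
theorem coeffVec_map {F : Type w} [FunLike F A B] [RingHomClass F A B] (φ : F) (c : ℕ) (f : A[X]) :
    coeffVec c (f.map (φ : A →+* B)) = ⇑φ ∘ coeffVec c f := by
  funext i
  simp [coeffVec, Polynomial.coeff_map]

/-- `monicOf` commutes with ring maps («compatible with change of the base ring», p0006 L67–L68).
[cite: Villamayor2007, Def. 1.2 p0006 L67–L68] -/
theorem monicOf_map {F : Type w} [FunLike F A B] [RingHomClass F A B] (φ : F) (a : Fin b → A) :
    (monicOf a).map (φ : A →+* B) = monicOf (⇑φ ∘ a) := by
  simp [monicOf, Polynomial.map_sum]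

/-- `Tay`/`taylor` commutes with ring maps: «the morphism `Tay`, and the operators `Δ^r`, are compatible with change
of the base ring `S`» (p0006 L67–L68). [cite: Villamayor2007, Def. 1.2 p0006 L67–L68] -/
theorem taylor_map {F : Type w} [FunLike F A B] [RingHomClass F A B] (φ : F) (s : A) (f : A[X]) :
    (Polynomial.taylor s f).map (φ : A →+* B) = Polynomial.taylor (φ s) (f.map (φ : A →+* B)) := by
  rw [Polynomial.taylor_apply, Polynomial.taylor_apply, Polynomial.map_comp]
  simp

/-- The coefficient vector of `monicOf a` is `a`. [cite: Villamayor2007, §1.5 p0007 L15] -/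
theorem coeffVec_monicOf (a : Fin b → A) : coeffVec b (monicOf a) = a := by
  funext i
  exact coeff_monicOf_of_lt a i

/-- The lower-order part of `monicOf a` has degree `< b`. [cite: Villamayor2007, §1.5 p0007 L15] -/
theorem degree_sum_lt (a : Fin b → A) :
    (∑ i : Fin b, Polynomial.C (a i) * Polynomial.X ^ (b - 1 - (i : ℕ))).degree < (b : WithBot ℕ) := by
  refine lt_of_le_of_lt (Polynomial.degree_sum_le _ _) ?_
  refine (Finset.sup_lt_iff ?_).mpr fun i _ => ?_
  · exact WithBot.bot_lt_coe b
  refine lt_of_le_of_lt (Polynomial.degree_C_mul_X_pow_le _ _) ?_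
  have hi : (i : ℕ) < b := i.2
  have hlt : b - 1 - (i : ℕ) < b := by omega
  exact WithBot.coe_lt_coe.mpr hlt

/-- `monicOf a` has degree `b` («monic polynomial of degree `b`», p0007 L15). [cite: Villamayor2007, §1.5 p0007 L15] -/
theorem natDegree_monicOf [Nontrivial A] (a : Fin b → A) : (monicOf a).natDegree = b := by
  have h : (∑ i : Fin b, Polynomial.C (a i) * Polynomial.X ^ (b - 1 - (i : ℕ))).degree <
      ((Polynomial.X : A[X]) ^ b).degree := by
    rw [Polynomial.degree_X_pow]
    exact degree_sum_lt a
  rw [monicOf, Polynomial.natDegree_add_eq_left_of_degree_lt h, Polynomial.natDegree_X_pow]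

/-- `monicOf a` is monic (p0007 L15). [cite: Villamayor2007, §1.5 p0007 L15] -/
theorem monicOf_monic (a : Fin b → A) : (monicOf a).Monic := by
  rcases subsingleton_or_nontrivial A with hA | hA
  · exact Subsingleton.elim _ _
  · have h : (∑ i : Fin b, Polynomial.C (a i) * Polynomial.X ^ (b - 1 - (i : ℕ))).degree <
        ((Polynomial.X : A[X]) ^ b).degree := by
      rw [Polynomial.degree_X_pow]
      exact degree_sum_lt a
    rw [monicOf]
    exact (Polynomial.monic_X_pow b).add_of_left h

/-- The change `Z₁ = uZ` on coefficients, `a_i ↦ u^i a_i`, IS Mathlib's `scaleRoots` (the monic polynomial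
`u^b f(Z₁/u)` whose roots are `u` times those of `f`), p0007 L40 «`Z₁ = uZ − s`».
[cite: Villamayor2007, §1.5 p0007 L40–L42] -/
theorem coeffVec_scaleRoots_monicOf [Nontrivial A] (a : Fin b → A) (u : A) :
    coeffVec b ((monicOf a).scaleRoots u) = fun i => a i * u ^ ((i : ℕ) + 1) := by
  funext i
  have hi : (i : ℕ) < b := i.2
  have hexp : b - (b - 1 - (i : ℕ)) = (i : ℕ) + 1 := by omega
  show ((monicOf a).scaleRoots u).coeff (b - 1 - (i : ℕ)) = _
  rw [Polynomial.coeff_scaleRoots, natDegree_monicOf, coeff_monicOf_of_lt, hexp]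

/-- `monicOf` of the rescaled vector is the rescaled polynomial. [cite: Villamayor2007, §1.5 p0007 L40–L42] -/
theorem monicOf_scale [Nontrivial A] (a : Fin b → A) (u : A) :
    monicOf (fun i => a i * u ^ ((i : ℕ) + 1)) = (monicOf a).scaleRoots u := by
  rw [← coeffVec_scaleRoots_monicOf a u]
  exact monicOf_coeffVec ((Polynomial.monic_scaleRoots_iff u).mpr (monicOf_monic a))
    (by rw [Polynomial.natDegree_scaleRoots, natDegree_monicOf])

/-- `taylor t (∏ (Z − y_i)) = ∏ (Z − (y_i − t))`: the change `Z₁ = Z − t` translates the roots.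
[cite: Villamayor2007, §1.1 p0006 L50–L52] -/
theorem taylor_prod_X_sub_C {ι : Type w} (s : Finset ι) (y : ι → A) (t : A) :
    Polynomial.taylor t (∏ i ∈ s, (Polynomial.X - Polynomial.C (y i))) =
      ∏ i ∈ s, (Polynomial.X - Polynomial.C (y i - t)) := by
  have h : ∀ p : A[X], Polynomial.taylor t p = Polynomial.taylorAlgHom t p := fun p => rfl
  rw [h, map_prod]
  refine Finset.prod_congr rfl fun i _ => ?_
  rw [← h, map_sub, Polynomial.taylor_X, Polynomial.taylor_C, Polynomial.C_sub]
  ring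

end PolyLemmas

/-! ## The universal step: `R[E₁,…,E_b] → R[Y₁,…,Y_b]`, `E_i ↦ s_{b,i}`, is injective and carries `f₀` to `F_b` -/

section Universal

variable {k : Type v} [CommRing k] {b : ℕ} {R : Type w} [CommRing R] [Algebra k R]

/-- INJECTIVITY of `E_i ↦ s_{b,i}(Y₁,…,Y_b)` on `R[E₁,…,E_b] → R[Y₁,…,Y_b]` over any commutative ring `R`
(«`R_b = k[s_{b,1},…,s_{b,b}]`» is a POLYNOMIAL ring, (1.5.1) p0007 L18–L21; Mathlib's fundamental theorem
`MvPolynomial.esymmAlgHom_injective`). [cite: Villamayor2007, (1.5.1) p0007 L18–L21] -/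
theorem aeval_esymm_injective :
    Function.Injective
      (aeval (fun i : Fin b => esymm (Fin b) R ((i : ℕ) + 1)) :
        MvPolynomial (Fin b) R →ₐ[R] MvPolynomial (Fin b) R) := by
  intro p q hpq
  have h : ∀ x : MvPolynomial (Fin b) R,
      aeval (fun i : Fin b => esymm (Fin b) R ((i : ℕ) + 1)) x = (esymmAlgHom (Fin b) R b x).val :=
    fun x => (esymmAlgHom_apply x).symm
  have hpq' : (esymmAlgHom (Fin b) R b p).val = (esymmAlgHom (Fin b) R b q).val := by
    rw [← h, ← h]; exact hpq
  exact esymmAlgHom_injective R (Fintype.card_fin b).ge (Subtype.ext hpq')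

/-- The coefficient vector of the universal polynomial: `coeffVec b F_b = ((−1)^{i+1} s_{b,i+1})_i`
(«`F_b(Z) = Z^b − s_{b,1}Z^{b−1} + … + (−1)^b s_{b,b}`», p0007 L13). [cite: Villamayor2007, §1.5 p0007 L13] -/
theorem coeffVec_univMonic (i : Fin b) :
    coeffVec b (univMonic (Fin b) R) i = (-1) ^ ((i : ℕ) + 1) * esymm (Fin b) R ((i : ℕ) + 1) := by
  have hi : (i : ℕ) < b := i.2
  have hcard : Fintype.card (Fin b) - (b - 1 - (i : ℕ)) = (i : ℕ) + 1 := by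
    rw [Fintype.card_fin]; omega
  show (univMonic (Fin b) R).coeff (b - 1 - (i : ℕ)) = _
  rw [coeff_univMonic (by rw [Fintype.card_fin]; omega), hcard]

/-- `E_i ↦ s_{b,i}` sends the universal coefficient vector `a₀ = ((−1)^{i+1} E_i)_i` to that of `F_b`.
[cite: Villamayor2007, §1.5 p0007 L13–L16] -/
theorem aeval_esymm_comp_univCoeff :
    (⇑(aeval (fun i : Fin b => esymm (Fin b) R ((i : ℕ) + 1)) :
        MvPolynomial (Fin b) R →ₐ[R] MvPolynomial (Fin b) R)) ∘
        (fun i : Fin b => (-1 : MvPolynomial (Fin b) R) ^ ((i : ℕ) + 1) * X i) =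
      coeffVec b (univMonic (Fin b) R) := by
  funext i
  rw [Function.comp_apply, map_mul, map_pow, map_neg, map_one, aeval_X, coeffVec_univMonic]

/-- **Specializing at the coefficients of `F_b` is the inclusion `R_b ⊂ k[Y]`** (here into `R[Y]` for any
`k`-algebra `R`): «`R_b` is mapped to `S`, so that `F_b(Z)` defines `f(Z)`» with `S = R[Y]`, `f = F_b` (p0007
L63–L64). [cite: Villamayor2007, §1.5 p0007 L63–L64] -/
theorem specialize_coeffVec_univMonic (G : symmetricSubalgebra (Fin b) k) :
    specialize k (coeffVec b (univMonic (Fin b) R)) G =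
      aeval (fun i : Fin b => (X i : MvPolynomial (Fin b) R)) (G : MvPolynomial (Fin b) k) := by
  -- the values `(−1)^{i+1} * a i` of `specialize` at `a = coeffVec b F_b` are the `s_{b,i+1}(Y)`
  have hval : (fun i : Fin b => (-1 : MvPolynomial (Fin b) R) ^ ((i : ℕ) + 1) *
      coeffVec b (univMonic (Fin b) R) i) = fun i : Fin b => esymm (Fin b) R ((i : ℕ) + 1) := by
    funext i
    rw [coeffVec_univMonic, ← mul_assoc, ← pow_add, ← two_mul, pow_mul, neg_one_sq, one_pow, one_mul]
  -- `G` written in the `s_{b,i}`: `G = P(s_{b,1},…,s_{b,b})`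
  let P : MvPolynomial (Fin b) k := (esymmAlgEquiv (Fin b) k (Fintype.card_fin b)).symm G
  have hG : (G : MvPolynomial (Fin b) k) = aeval (fun i : Fin b => esymm (Fin b) k ((i : ℕ) + 1)) P := by
    have h1 : G = esymmAlgEquiv (Fin b) k (Fintype.card_fin b) P := by
      simp only [P, AlgEquiv.apply_symm_apply]
    conv_lhs => rw [h1]
    rw [esymmAlgEquiv_apply]
    exact esymmAlgHom_apply P
  have hL : specialize k (coeffVec b (univMonic (Fin b) R)) G =
      aeval (fun i : Fin b => (-1 : MvPolynomial (Fin b) R) ^ ((i : ℕ) + 1) *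
        coeffVec b (univMonic (Fin b) R) i) P := rfl
  have hfg : (fun i : Fin b => aeval (fun j : Fin b => (X j : MvPolynomial (Fin b) R))
      (esymm (Fin b) k ((i : ℕ) + 1))) = fun i : Fin b => esymm (Fin b) R ((i : ℕ) + 1) := by
    funext i
    rw [aeval_esymm_eq_multiset_esymm, esymm_eq_multiset_esymm]
  rw [hL, hval, hG, comp_aeval_apply, hfg]

/-- **The universal case of `Z₁ = Z − t`** (p0007 L41–L42 «it suffices … to restrict to changes of the form
`Z₁ = Z − s`, at the universal level»): over `S₀ = R[E₁,…,E_b]` with `a₀ = ((−1)^{i+1}E_i)_i` and any `t ∈ R`,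
every `G ∈ R̄_b` takes the same value at the coefficients of `taylor t f₀` and of `f₀ = monicOf a₀`. Proof: apply the
injective `E ↦ s(Y)`; the claim becomes `G(Y₁ − t, …, Y_b − t) = G(Y)`. [cite: Villamayor2007, §1.5 p0007 L41–L42] -/
theorem specialize_taylor_univ [Nontrivial R] (t : R) {G : MvPolynomial (Fin b) k}
    (hG : G ∈ univElimOne (Fin b) k) :
    specialize k (coeffVec b (Polynomial.taylor (C t)
        (monicOf (fun i : Fin b => (-1 : MvPolynomial (Fin b) R) ^ ((i : ℕ) + 1) * X i))))
        ⟨G, univElimOne_le_symmetricSubalgebra hG⟩ =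
      specialize k (fun i : Fin b => (-1 : MvPolynomial (Fin b) R) ^ ((i : ℕ) + 1) * X i)
        ⟨G, univElimOne_le_symmetricSubalgebra hG⟩ := by
  let G' : symmetricSubalgebra (Fin b) k := ⟨G, univElimOne_le_symmetricSubalgebra hG⟩
  let a₀ : Fin b → MvPolynomial (Fin b) R := fun i => (-1 : MvPolynomial (Fin b) R) ^ ((i : ℕ) + 1) * X i
  let Φ : MvPolynomial (Fin b) R →ₐ[R] MvPolynomial (Fin b) R :=
    aeval (fun i : Fin b => esymm (Fin b) R ((i : ℕ) + 1))
  let ρ : MvPolynomial (Fin b) R →ₐ[R] MvPolynomial (Fin b) R :=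
    aeval (fun i : Fin b => (X i : MvPolynomial (Fin b) R) - C t)
  have hΦa₀ : ⇑Φ ∘ a₀ = coeffVec b (univMonic (Fin b) R) := aeval_esymm_comp_univCoeff
  have hΦt : Φ (C t) = C t := Φ.commutes t
  -- `Φ ∘ coeffVec (taylor t f₀) = coeffVec (taylor t F_b) = coeffVec (F_b.map ρ) = ρ ∘ coeffVec F_b`
  have hprod : (∏ i : Fin b, (Polynomial.X - Polynomial.C ((X i : MvPolynomial (Fin b) R) - C t))) =
      (univMonic (Fin b) R).map (ρ : MvPolynomial (Fin b) R →+* MvPolynomial (Fin b) R) := by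
    rw [univMonic, Polynomial.map_prod]
    refine Finset.prod_congr rfl fun i _ => ?_
    simp [ρ]
  have hΦlhs : ⇑Φ ∘ coeffVec b (Polynomial.taylor (C t) (monicOf a₀)) =
      ⇑ρ ∘ coeffVec b (univMonic (Fin b) R) := by
    rw [← coeffVec_map Φ, taylor_map Φ, monicOf_map Φ, hΦt, hΦa₀,
      monicOf_coeffVec univMonic_monic (by rw [natDegree_univMonic, Fintype.card_fin]), univMonic,
      taylor_prod_X_sub_C, hprod, coeffVec_map ρ, ← univMonic]
  change specialize k (coeffVec b (Polynomial.taylor (C t) (monicOf a₀))) G' = specialize k a₀ G'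
  apply aeval_esymm_injective
  change (Φ.restrictScalars k) (specialize k _ G') = (Φ.restrictScalars k) (specialize k a₀ G')
  rw [← AlgHom.comp_apply, ← specialize_comp, ← AlgHom.comp_apply (Φ.restrictScalars k), ← specialize_comp,
    AlgHom.coe_restrictScalars', hΦa₀, hΦlhs]
  have hρ : ⇑ρ = ⇑(ρ.restrictScalars k) := rfl
  rw [hρ, specialize_comp, AlgHom.comp_apply, specialize_coeffVec_univMonic, comp_aeval_apply]
  -- root level: `G(Y − t) = G(Y)`
  have hval : (fun i : Fin b => (ρ.restrictScalars k) (X i : MvPolynomial (Fin b) R)) =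
      fun i => (X i : MvPolynomial (Fin b) R) + (-C t) := by
    funext i
    rw [AlgHom.restrictScalars_apply, aeval_X, sub_eq_add_neg]
  rw [hval]
  exact aeval_add_const_of_mem_diffSubalgebra _ _ hG.1

/-- **The universal case of `Z₁ = uZ`**: over `S₀ = R[E₁,…,E_b]`, `a₀ = ((−1)^{i+1}E_i)_i`, `u₀ = t ∈ R`, a
homogeneous `G ∈ [R̄_b]_r` takes at the rescaled coefficients `(u₀^{i} (a₀)_i)_i` the value `u₀^r` times its value
at `a₀` («weighted homogeneous on the symmetric functions `s_{b,i}`», p0007 L83). Proof: apply the injective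
`E ↦ s(Y)`; the claim becomes `G(tY) = t^r G(Y)`. [cite: Villamayor2007, §1.5 p0007 L81–L83] -/
theorem specialize_scale_univ (t : R) {G : MvPolynomial (Fin b) k} {r : ℕ}
    (hG : G ∈ univElimPiece (Fin b) k (fun _ : Fin b => ()) r) :
    specialize k (fun i : Fin b => ((-1 : MvPolynomial (Fin b) R) ^ ((i : ℕ) + 1) * X i) * C t ^ ((i : ℕ) + 1))
        ⟨G, univElimOne_le_symmetricSubalgebra hG.1⟩ =
      C t ^ r * specialize k (fun i : Fin b => (-1 : MvPolynomial (Fin b) R) ^ ((i : ℕ) + 1) * X i)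
        ⟨G, univElimOne_le_symmetricSubalgebra hG.1⟩ := by
  let G' : symmetricSubalgebra (Fin b) k := ⟨G, univElimOne_le_symmetricSubalgebra hG.1⟩
  let a₀ : Fin b → MvPolynomial (Fin b) R := fun i => (-1 : MvPolynomial (Fin b) R) ^ ((i : ℕ) + 1) * X i
  let Φ : MvPolynomial (Fin b) R →ₐ[R] MvPolynomial (Fin b) R :=
    aeval (fun i : Fin b => esymm (Fin b) R ((i : ℕ) + 1))
  let σ : MvPolynomial (Fin b) R →ₐ[R] MvPolynomial (Fin b) R :=
    aeval (fun i : Fin b => C t * (X i : MvPolynomial (Fin b) R))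
  have hΦa₀ : ⇑Φ ∘ a₀ = coeffVec b (univMonic (Fin b) R) := aeval_esymm_comp_univCoeff
  have hΦt : Φ (C t) = C t := Φ.commutes t
  -- `Φ ∘ (t^i · a₀) = σ ∘ coeffVec F_b`, by homogeneity of the `s_{b,i}`
  have hσ : ∀ i : Fin b, σ (esymm (Fin b) R ((i : ℕ) + 1)) =
      C t ^ ((i : ℕ) + 1) * esymm (Fin b) R ((i : ℕ) + 1) := by
    intro i
    have h := aeval_const_mul_of_isHomogeneous (k := R) (fun j : Fin b => (X j : MvPolynomial (Fin b) R))
      (C t) (isHomogeneous_esymm_univ (k := R) (ι := Fin b) ((i : ℕ) + 1))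
    rw [aeval_X_left_apply] at h
    exact h
  have hΦlhs : ⇑Φ ∘ (fun i => a₀ i * C t ^ ((i : ℕ) + 1)) = ⇑σ ∘ coeffVec b (univMonic (Fin b) R) := by
    funext i
    have h1 : Φ (a₀ i) = coeffVec b (univMonic (Fin b) R) i := congrFun hΦa₀ i
    rw [Function.comp_apply, Function.comp_apply, map_mul, map_pow, h1, hΦt, coeffVec_univMonic, map_mul,
      map_pow, map_neg, map_one, hσ]
    ring
  change specialize k (fun i => a₀ i * C t ^ ((i : ℕ) + 1)) G' = C t ^ r * specialize k a₀ G'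
  apply aeval_esymm_injective
  change (Φ.restrictScalars k) (specialize k _ G') = (Φ.restrictScalars k) (C t ^ r * specialize k a₀ G')
  rw [map_mul, map_pow, ← AlgHom.comp_apply, ← specialize_comp, ← AlgHom.comp_apply (Φ.restrictScalars k),
    ← specialize_comp, AlgHom.coe_restrictScalars', hΦa₀, hΦlhs, hΦt]
  have hσ' : ⇑σ = ⇑(σ.restrictScalars k) := rfl
  rw [hσ', specialize_comp, AlgHom.comp_apply, specialize_coeffVec_univMonic, comp_aeval_apply]
  -- root level: `G(tY) = t^r G(Y)`
  have hval : (fun i : Fin b => (σ.restrictScalars k) (X i : MvPolynomial (Fin b) R)) =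
      fun i => C t * (X i : MvPolynomial (Fin b) R) := by
    funext i
    rw [AlgHom.restrictScalars_apply, aeval_X]
  rw [hval]
  exact aeval_const_mul_of_isHomogeneous _ _ hG.2

end Universal

/-! ## Main theorems: `Z₁ = Z − s` -/

section Translation

variable (k : Type v) [CommRing k] {S : Type w} [CommRing S] [Algebra k S] {b : ℕ}

/-- **Translation invariance at the level of coefficients** [Villamayor 2007, §1.5 p0007 L57–L60 «Elements of
`R̄_b`, are elements in `R_b`, that provide, for every monic polynomial `f(Z) ∈ S[Z]` of degree `b`, equations on the
coefficients which are independent of changes of the form `Z₁ = Z − s`, `s ∈ S`»; p0007 L81 «each `h_i` is invariant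
by such change»]: for every `G ∈ R̄_b`, every `k`-algebra `S`, `a : Fin b → S` and `s ∈ S`, the value of `G` at the
coefficients of `f(Z + s) = taylor s (monicOf a)` equals its value at the coefficients of `f = monicOf a`. The proof
is the printed reduction to the universal level (`specialize_taylor_univ` over `k[T]`, then `T ↦ s`, `E_i ↦ ±a_i`).
[cite: Villamayor2007, §1.5 p0007 L57–L60] -/
theorem specialize_taylor (a : Fin b → S) (s : S) {G : MvPolynomial (Fin b) k} (hG : G ∈ univElimOne (Fin b) k) :
    specialize k (coeffVec b (Polynomial.taylor s (monicOf a))) ⟨G, univElimOne_le_symmetricSubalgebra hG⟩ =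
      specialize k a ⟨G, univElimOne_le_symmetricSubalgebra hG⟩ := by
  rcases subsingleton_or_nontrivial k with hk | hk
  · have : Subsingleton S := by
      refine subsingleton_of_zero_eq_one ?_
      rw [← (algebraMap k S).map_one, Subsingleton.elim (1 : k) 0, map_zero]
    exact Subsingleton.elim _ _
  -- transport the universal identity over `R = k[T]` along `ψ : k[T][E] → S`, `E_i ↦ (−1)^{i+1} a_i`, `T ↦ s`
  let G' : symmetricSubalgebra (Fin b) k := ⟨G, univElimOne_le_symmetricSubalgebra hG⟩
  let a₀ : Fin b → MvPolynomial (Fin b) (Polynomial k) :=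
    fun i => (-1 : MvPolynomial (Fin b) (Polynomial k)) ^ ((i : ℕ) + 1) * X i
  let ψ : MvPolynomial (Fin b) (Polynomial k) →ₐ[k] S :=
    aevalTower (Polynomial.aeval s) (fun i : Fin b => (-1 : S) ^ ((i : ℕ) + 1) * a i)
  have hψa₀ : ⇑ψ ∘ a₀ = a := by
    funext i
    rw [Function.comp_apply, map_mul, map_pow, map_neg, map_one, aevalTower_X, ← mul_assoc, ← pow_add,
      ← two_mul, pow_mul, neg_one_sq, one_pow, one_mul]
  have hψT : ψ (C Polynomial.X) = s := by
    rw [aevalTower_C, Polynomial.aeval_X]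
  have hψlhs : ⇑ψ ∘ coeffVec b (Polynomial.taylor (C Polynomial.X) (monicOf a₀)) =
      coeffVec b (Polynomial.taylor s (monicOf a)) := by
    rw [← coeffVec_map ψ, taylor_map ψ, monicOf_map ψ, hψa₀, hψT]
  have h := congrArg ψ (specialize_taylor_univ (R := Polynomial k) Polynomial.X hG)
  change ψ (specialize k (coeffVec b (Polynomial.taylor (C Polynomial.X) (monicOf a₀))) G') =
    ψ (specialize k a₀ G') at h
  rw [← AlgHom.comp_apply, ← specialize_comp, ← AlgHom.comp_apply ψ, ← specialize_comp, hψa₀, hψlhs] at h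
  exact h

variable {k}

/-- **`I_r` is invariant under `Z₁ = Z − s`** [Villamayor 2007, §1.5 p0007 L80–L81 «the ideal `I_r` is generated by
polynomials on the coefficients of `f(Z)`. They are clearly invariants by a change of variable `Z₁ = Z − s`, `s ∈ S`»]:
`I_r(f(Z + s)) = I_r(f(Z))` — the generators are literally the same elements of `S`.
[cite: Villamayor2007, §1.5 p0007 L80–L81] -/
theorem elimIdeal_taylor (a : Fin b → S) (s : S) (r : ℕ) :
    elimIdeal k (coeffVec b (Polynomial.taylor s (monicOf a))) r = elimIdeal k a r := by
  rw [elimIdeal, elimIdeal]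
  congr 1
  ext x
  simp only [elimGen, Set.mem_range]
  constructor
  · rintro ⟨H, rfl⟩
    exact ⟨H, (specialize_taylor k a s H.2.1).symm⟩
  · rintro ⟨H, rfl⟩
    exact ⟨H, specialize_taylor k a s H.2.1⟩

/-- **`R̄_f` is invariant under `Z₁ = Z − s`**: `R̄_{f(Z+s)} = R̄_{f} ⊂ S[W]`. [cite: Villamayor2007, §1.5 p0007 L80–L81] -/
theorem elimAlgebra_taylor (a : Fin b → S) (s : S) :
    elimAlgebra k (coeffVec b (Polynomial.taylor s (monicOf a))) = elimAlgebra k a := by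
  rw [elimAlgebra, elimAlgebra]
  congr 1
  funext r
  exact elimIdeal_taylor a s r

/-- `ℋ_f` (Def. 1.42 (1.42.3)) is likewise invariant under `Z₁ = Z − s` (its generators lie in `H_{F_b} ⊆ R̄_b`).
[cite: Villamayor2007, §1.5 p0007 L80–L81] -/
theorem hElimIdeal_taylor (a : Fin b → S) (s : S) (r : ℕ) :
    hElimIdeal k (coeffVec b (Polynomial.taylor s (monicOf a))) r = hElimIdeal k a r := by
  rw [hElimIdeal, hElimIdeal]
  congr 1
  ext x
  simp only [hElimGen, Set.mem_setOf_eq]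
  constructor
  · rintro ⟨H, hH, hhom, rfl⟩
    exact ⟨H, hH, hhom, specialize_taylor k a s (hSubalgebra_le_univElimOne hH)⟩
  · rintro ⟨H, hH, hhom, rfl⟩
    exact ⟨H, hH, hhom, (specialize_taylor k a s (hSubalgebra_le_univElimOne hH)).symm⟩

/-- `ℋ_{f(Z+s)} = ℋ_f`. [cite: Villamayor2007, §1.5 p0007 L80–L81] -/
theorem hElimAlgebra_taylor (a : Fin b → S) (s : S) :
    hElimAlgebra k (coeffVec b (Polynomial.taylor s (monicOf a))) = hElimAlgebra k a := by
  rw [hElimAlgebra, hElimAlgebra]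
  congr 1
  funext r
  exact hElimIdeal_taylor a s r

/-- Version for an arbitrary monic `f ∈ S[Z]` of degree `b` («for every monic polynomial `f(Z) ∈ S[Z]` of degree
`b`», p0007 L57–L58): `I_r(f(Z+s)) = I_r(f)`. [cite: Villamayor2007, §1.5 p0007 L57–L60] -/
theorem elimIdeal_taylor_of_monic {f : S[X]} (hmonic : f.Monic) (hdeg : f.natDegree = b) (s : S) (r : ℕ) :
    elimIdeal k (coeffVec b (Polynomial.taylor s f)) r = elimIdeal k (coeffVec b f) r := by
  conv_lhs => rw [← monicOf_coeffVec hmonic hdeg]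
  exact elimIdeal_taylor _ s r

/-- `R̄_{f(Z+s)} = R̄_f` for an arbitrary monic `f` of degree `b`. [cite: Villamayor2007, §1.5 p0007 L57–L60] -/
theorem elimAlgebra_taylor_of_monic {f : S[X]} (hmonic : f.Monic) (hdeg : f.natDegree = b) (s : S) :
    elimAlgebra k (coeffVec b (Polynomial.taylor s f)) = elimAlgebra k (coeffVec b f) := by
  conv_lhs => rw [← monicOf_coeffVec hmonic hdeg]
  exact elimAlgebra_taylor _ s

/-- «changes of variables of the form `Z₁ = Z − s`, `s ∈ S` do not affect the finite extension
`S ⊂ S[Z]/⟨f(Z)⟩`» (p0006 L50–L52): `Z ↦ Z₁ + s` is an `S`-algebra isomorphism `S[Z]/⟨f(Z)⟩ ≃ S[Z₁]/⟨f(Z₁ + s)⟩`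
(Mathlib's `taylorEquiv`). [cite: Villamayor2007, §1.1 p0006 L50–L52] -/
theorem nonempty_algEquiv_quotient_taylor (f : S[X]) (s : S) :
    Nonempty ((S[X] ⧸ Ideal.span {f}) ≃ₐ[S] (S[X] ⧸ Ideal.span {Polynomial.taylor s f})) := by
  refine ⟨Ideal.quotientEquivAlg (Ideal.span {f}) (Ideal.span {Polynomial.taylor s f})
    (Polynomial.taylorEquiv s) ?_⟩
  rw [Ideal.map_span, Set.image_singleton]
  rfl

end Translation

/-! ## Main theorems: `Z₁ = uZ` and `Z₁ = uZ − s` -/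

section Scaling

variable (k : Type v) [CommRing k] {S : Type w} [CommRing S] [Algebra k S] {b : ℕ}

/-- **Homogeneous invariants are SEMI-invariant under `Z₁ = uZ`** [Villamayor 2007, §1.5 p0007 L81–L83 «each
ideal `I_r` will be independent of any change `Z₁ = uZ − s` in `S[Z]`. This last property will rely on the fact that
the previous (universal) `H_i` are weighted homogeneous on the symmetric functions `s_{b,i}`»]: for `G ∈ [R̄_b]_r`
(homogeneous of degree `r`) and ANY `u ∈ S`, the value at the rescaled coefficients `(u^{i} a_i)_i` is `u^r` times the
value at `a`. [cite: Villamayor2007, §1.5 p0007 L81–L83] -/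
theorem specialize_scale (a : Fin b → S) (u : S) {G : MvPolynomial (Fin b) k} {r : ℕ}
    (hG : G ∈ univElimPiece (Fin b) k (fun _ : Fin b => ()) r) :
    specialize k (fun i => a i * u ^ ((i : ℕ) + 1)) ⟨G, univElimOne_le_symmetricSubalgebra hG.1⟩ =
      u ^ r * specialize k a ⟨G, univElimOne_le_symmetricSubalgebra hG.1⟩ := by
  -- transport the universal identity over `R = k[T]` along `ψ : k[T][E] → S`, `E_i ↦ (−1)^{i+1} a_i`, `T ↦ u`
  let G' : symmetricSubalgebra (Fin b) k := ⟨G, univElimOne_le_symmetricSubalgebra hG.1⟩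
  let a₀ : Fin b → MvPolynomial (Fin b) (Polynomial k) :=
    fun i => (-1 : MvPolynomial (Fin b) (Polynomial k)) ^ ((i : ℕ) + 1) * X i
  let ψ : MvPolynomial (Fin b) (Polynomial k) →ₐ[k] S :=
    aevalTower (Polynomial.aeval u) (fun i : Fin b => (-1 : S) ^ ((i : ℕ) + 1) * a i)
  have hψa₀ : ∀ i, ψ (a₀ i) = a i := by
    intro i
    rw [map_mul, map_pow, map_neg, map_one, aevalTower_X, ← mul_assoc, ← pow_add, ← two_mul, pow_mul,
      neg_one_sq, one_pow, one_mul]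
  have hψa₀' : ⇑ψ ∘ a₀ = a := funext hψa₀
  have hψT : ψ (C Polynomial.X) = u := by
    rw [aevalTower_C, Polynomial.aeval_X]
  have hψlhs : ⇑ψ ∘ (fun i => a₀ i * C Polynomial.X ^ ((i : ℕ) + 1)) = fun i => a i * u ^ ((i : ℕ) + 1) := by
    funext i
    rw [Function.comp_apply, map_mul, map_pow, hψa₀, hψT]
  have h := congrArg ψ (specialize_scale_univ (R := Polynomial k) Polynomial.X hG)
  change ψ (specialize k (fun i => a₀ i * C Polynomial.X ^ ((i : ℕ) + 1)) G') =
    ψ (C Polynomial.X ^ r * specialize k a₀ G') at h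
  rw [map_mul, map_pow, hψT, ← AlgHom.comp_apply, ← specialize_comp, ← AlgHom.comp_apply ψ,
    ← specialize_comp, hψa₀', hψlhs] at h
  exact h

variable {k}

/-- **`I_r` scales by `u^r` under `Z₁ = uZ`**: `I_r((u^i a_i)_i) = u^r · I_r(a)` for any `u ∈ S`.
[cite: Villamayor2007, §1.5 p0007 L81–L83] -/
theorem elimIdeal_scale (a : Fin b → S) (u : S) (r : ℕ) :
    elimIdeal k (fun i => a i * u ^ ((i : ℕ) + 1)) r = Ideal.span {u ^ r} * elimIdeal k a r := by
  rw [elimIdeal, elimIdeal, Ideal.span_mul_span', Set.singleton_mul]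
  congr 1
  ext x
  simp only [elimGen, Set.mem_range, Set.mem_image]
  constructor
  · rintro ⟨H, rfl⟩
    exact ⟨_, ⟨H, rfl⟩, (specialize_scale k a u H.2).symm⟩
  · rintro ⟨_, ⟨H, rfl⟩, rfl⟩
    exact ⟨H, specialize_scale k a u H.2⟩

/-- **`I_r` is invariant under `Z₁ = uZ` for a unit `u`** (p0007 L40 «`u` is a unit of `S`»; L82 «each ideal `I_r` will
be independent of any change `Z₁ = uZ − s`»). [cite: Villamayor2007, §1.5 p0007 L81–L83] -/
theorem elimIdeal_scale_of_isUnit (a : Fin b → S) {u : S} (hu : IsUnit u) (r : ℕ) :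
    elimIdeal k (fun i => a i * u ^ ((i : ℕ) + 1)) r = elimIdeal k a r := by
  rw [elimIdeal_scale, Ideal.span_singleton_eq_top.mpr (hu.pow r), Ideal.top_mul]

/-- **`R̄_f` is invariant under `Z₁ = uZ` for a unit `u`.** [cite: Villamayor2007, §1.5 p0007 L81–L83] -/
theorem elimAlgebra_scale_of_isUnit (a : Fin b → S) {u : S} (hu : IsUnit u) :
    elimAlgebra k (fun i => a i * u ^ ((i : ℕ) + 1)) = elimAlgebra k a := by
  rw [elimAlgebra, elimAlgebra]
  congr 1
  funext r
  exact elimIdeal_scale_of_isUnit a hu r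

/-- `ℋ_f` scales the same way: `I^{(2)}_r((u^i a_i)_i) = u^r · I^{(2)}_r(a)`. [cite: Villamayor2007, §1.5 p0007 L81–L83] -/
theorem hElimIdeal_scale (a : Fin b → S) (u : S) (r : ℕ) :
    hElimIdeal k (fun i => a i * u ^ ((i : ℕ) + 1)) r = Ideal.span {u ^ r} * hElimIdeal k a r := by
  rw [hElimIdeal, hElimIdeal, Ideal.span_mul_span', Set.singleton_mul]
  congr 1
  ext x
  simp only [hElimGen, Set.mem_setOf_eq, Set.mem_image]
  constructor
  · rintro ⟨H, hH, hhom, rfl⟩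
    exact ⟨_, ⟨H, hH, hhom, rfl⟩, (specialize_scale k a u ⟨hSubalgebra_le_univElimOne hH, hhom⟩).symm⟩
  · rintro ⟨_, ⟨H, hH, hhom, rfl⟩, rfl⟩
    exact ⟨H, hH, hhom, (specialize_scale k a u ⟨hSubalgebra_le_univElimOne hH, hhom⟩).symm⟩

/-- `ℋ_f` is invariant under `Z₁ = uZ` for a unit `u`. [cite: Villamayor2007, §1.5 p0007 L81–L83] -/
theorem hElimIdeal_scale_of_isUnit (a : Fin b → S) {u : S} (hu : IsUnit u) (r : ℕ) :
    hElimIdeal k (fun i => a i * u ^ ((i : ℕ) + 1)) r = hElimIdeal k a r := by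
  rw [hElimIdeal_scale, Ideal.span_singleton_eq_top.mpr (hu.pow r), Ideal.top_mul]

/-- **The combined change `Z₁ = uZ − s`** (`u` a unit, `s ∈ S`) [Villamayor 2007, §1.5 p0007 L81–L82 «each ideal
`I_r` will be independent of any change `Z₁ = uZ − s` in `S[Z]`»]: first rescale (`a_i ↦ u^i a_i`), then translate
(`f ↦ f(Z + s)`); `I_r` is unchanged. [cite: Villamayor2007, §1.5 p0007 L81–L82] -/
theorem elimIdeal_scale_taylor_of_isUnit (a : Fin b → S) {u : S} (hu : IsUnit u) (s : S) (r : ℕ) :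
    elimIdeal k (coeffVec b (Polynomial.taylor s (monicOf (fun i => a i * u ^ ((i : ℕ) + 1))))) r =
      elimIdeal k a r := by
  rw [elimIdeal_taylor, elimIdeal_scale_of_isUnit a hu]

/-- The same for `R̄_f`: `R̄` of `u^b f((Z₁ + s)/u)` equals `R̄_f`. [cite: Villamayor2007, §1.5 p0007 L81–L82] -/
theorem elimAlgebra_scale_taylor_of_isUnit (a : Fin b → S) {u : S} (hu : IsUnit u) (s : S) :
    elimAlgebra k (coeffVec b (Polynomial.taylor s (monicOf (fun i => a i * u ^ ((i : ℕ) + 1))))) =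
      elimAlgebra k a := by
  rw [elimAlgebra_taylor, elimAlgebra_scale_of_isUnit a hu]

/-- `scaleRoots` form, for an arbitrary monic `f` of degree `b` over a nontrivial `S`: `I_r(scaleRoots f u) =
u^r · I_r(f)`. [cite: Villamayor2007, §1.5 p0007 L81–L83] -/
theorem elimIdeal_scaleRoots_of_monic [Nontrivial S] {f : S[X]} (hmonic : f.Monic) (hdeg : f.natDegree = b)
    (u : S) (r : ℕ) :
    elimIdeal k (coeffVec b (f.scaleRoots u)) r = Ideal.span {u ^ r} * elimIdeal k (coeffVec b f) r := by
  rw [← elimIdeal_scale]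
  congr 1
  conv_lhs => rw [← monicOf_coeffVec hmonic hdeg]
  exact coeffVec_scaleRoots_monicOf _ u

/-- `scaleRoots` form of the invariance for a unit `u`: `I_r(scaleRoots f u) = I_r(f)`.
[cite: Villamayor2007, §1.5 p0007 L81–L83] -/
theorem elimIdeal_scaleRoots_of_monic_of_isUnit [Nontrivial S] {f : S[X]} (hmonic : f.Monic)
    (hdeg : f.natDegree = b) {u : S} (hu : IsUnit u) (r : ℕ) :
    elimIdeal k (coeffVec b (f.scaleRoots u)) r = elimIdeal k (coeffVec b f) r := by
  rw [elimIdeal_scaleRoots_of_monic hmonic hdeg, Ideal.span_singleton_eq_top.mpr (hu.pow r), Ideal.top_mul]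

end Scaling

end Literature.AlgebraicGeometry.Villamayor2007

end
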